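import Mathlib

/-!
# Submultiplicativity of the weighted `ℓ¹` size of power series

Stub `stub_weightedNormMul` for the crux `HilbertIntegralOverconvergentIsCongruence`
(line Sketch-ideate-r1-k1): for `t ≥ 0` the weighted size `W_t(φ) = ∑ₙ ‖coeff n φ‖ tⁿ` of a
complex power series satisfies `W_t(φ ψ) ≤ W_t(φ) W_t(ψ)` (with summability), via
`PowerSeries.coeff_mul` and the Cauchy product of nonnegative real series.
-/

set_option linter.dupNamespace false

noncomputable section

namespace Summit.Langlands.Langlands.Theorems.HilbertIntegralOverconvergentIsCongruence

/-- Submultiplicativity of the weighted `ℓ¹` size `W_t(φ) = ∑ₙ ‖φₙ‖ tⁿ` (`t ≥ 0`) of complex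
power series: if `W_t(φ)` and `W_t(ψ)` converge then so does `W_t(φ ψ)`, and
`W_t(φ ψ) ≤ W_t(φ) W_t(ψ)`. Proof: `coeff n (φ ψ) = ∑_{i+j=n} φᵢ ψⱼ`, so
`‖coeff n (φ ψ)‖ tⁿ ≤ ∑_{i+j=n} (‖φᵢ‖ tⁱ)(‖ψⱼ‖ tʲ)`, whose right-hand side is the `n`-th term of
the Cauchy product of two summable nonnegative real series. -/
theorem stub_weightedNormMul (φ ψ : PowerSeries ℂ) (t : ℝ) (ht : 0 ≤ t)
    (hφ : Summable fun n : ℕ ↦ ‖PowerSeries.coeff n φ‖ * t ^ n)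
    (hψ : Summable fun n : ℕ ↦ ‖PowerSeries.coeff n ψ‖ * t ^ n) :
    Summable (fun n : ℕ ↦ ‖PowerSeries.coeff n (φ * ψ)‖ * t ^ n) ∧
      ∑' n : ℕ, ‖PowerSeries.coeff n (φ * ψ)‖ * t ^ n ≤
        (∑' n : ℕ, ‖PowerSeries.coeff n φ‖ * t ^ n) * ∑' n : ℕ, ‖PowerSeries.coeff n ψ‖ * t ^ n := by
  set a : ℕ → ℝ := fun n ↦ ‖PowerSeries.coeff n φ‖ * t ^ n with ha_def
  set b : ℕ → ℝ := fun n ↦ ‖PowerSeries.coeff n ψ‖ * t ^ n with hb_def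
  have ha : 0 ≤ a := fun n ↦ mul_nonneg (norm_nonneg _) (pow_nonneg ht n)
  have hb : 0 ≤ b := fun n ↦ mul_nonneg (norm_nonneg _) (pow_nonneg ht n)
  -- the Cauchy product of the two nonnegative summable real series `a`, `b`
  have hab : Summable fun x : ℕ × ℕ ↦ a x.1 * b x.2 := hφ.mul_of_nonneg hψ ha hb
  have hsum : Summable fun n : ℕ ↦
      ∑ kl ∈ Finset.HasAntidiagonal.antidiagonal n, a kl.1 * b kl.2 :=
    summable_sum_mul_antidiagonal_of_summable_mul hab
  have heq : (∑' n, a n) * ∑' n, b n =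
      ∑' n, ∑ kl ∈ Finset.HasAntidiagonal.antidiagonal n, a kl.1 * b kl.2 :=
    hφ.tsum_mul_tsum_eq_tsum_sum_antidiagonal hψ hab
  -- termwise comparison with the Cauchy product
  have hle : ∀ n : ℕ, ‖PowerSeries.coeff n (φ * ψ)‖ * t ^ n ≤
      ∑ kl ∈ Finset.HasAntidiagonal.antidiagonal n, a kl.1 * b kl.2 := by
    intro n
    rw [PowerSeries.coeff_mul]
    calc ‖∑ p ∈ Finset.HasAntidiagonal.antidiagonal n,
            PowerSeries.coeff p.1 φ * PowerSeries.coeff p.2 ψ‖ * t ^ n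
        ≤ (∑ p ∈ Finset.HasAntidiagonal.antidiagonal n,
            ‖PowerSeries.coeff p.1 φ * PowerSeries.coeff p.2 ψ‖) * t ^ n :=
          mul_le_mul_of_nonneg_right (norm_sum_le _ _) (pow_nonneg ht n)
      _ = ∑ kl ∈ Finset.HasAntidiagonal.antidiagonal n, a kl.1 * b kl.2 := by
          rw [Finset.sum_mul]
          refine Finset.sum_congr rfl fun p hp ↦ ?_
          rw [Finset.HasAntidiagonal.mem_antidiagonal] at hp
          rw [norm_mul, ha_def, hb_def, ← hp, pow_add]
          ring
  have hnn : ∀ n : ℕ, 0 ≤ ‖PowerSeries.coeff n (φ * ψ)‖ * t ^ n := fun n ↦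
    mul_nonneg (norm_nonneg _) (pow_nonneg ht n)
  have hS : Summable fun n : ℕ ↦ ‖PowerSeries.coeff n (φ * ψ)‖ * t ^ n :=
    hsum.of_nonneg_of_le hnn hle
  refine ⟨hS, ?_⟩
  rw [heq]
  exact hS.tsum_le_tsum hle hsum

end Summit.Langlands.Langlands.Theorems.HilbertIntegralOverconvergentIsCongruence

end
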